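import Summits.NavierStokesRegularity.NavierStokesRegularity.Theorems.EulerZoomLiouvillePowerGaugeEulerLiouvilleWeakHighSetFluxTools

/-!
# «JETS MUST TURN» IN THE WEAK CLASS: the inflow flux of a Bernoulli high set through every sphere layer is matched by outflow flux
# (crux `EulerZoomLiouville.PowerGaugeEulerLiouville` = stmt-NavierStokesRegularity-19832, line `birth`, open stub `stub_selfSimilarWeakRest`)

Width seat `ns-ezl-w1` (g7) under the crux LEAD.  Assembly of `…WeakHighSetFluxTools` (exit law, mass between layers, outer flux, tails) —
the weak-class twin of g5's `HighSetFlux.flux_turning_law` / `bernoulli_flux_turning_law` (p662342), now for the SHARP high set `S = {ℋ > h}` of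
a weak class profile (no `C²`, no smoothing `S((ℋ−h)/η)`, no flow):

* **`WeakRenormalized.highSet_flux_turning_law`** — `0 ≤ γ ≤ ½`, weak class profile (`V ∈ L⁶_loc`, `G ∈ L²_loc`, `P ∈ L^{3/2}_loc`, div-free,
  Lamb form) with the `A`-growth `∫_{B_L}‖V‖² ≤ c_A L` (`L ≥ L₀`; the class has `L^{1−2ρ} ≤ L`), a layer `0 < r ≤ R`, and a level `h` whose far
  high set `{ℋ > h} ∩ {R(R−r) ≤ |x|²}` has finite volume ⇒
  `F_{R,r}({ℋ > h}) = ∫_{ℋ > h} −Dθ_{R,r}[W] ≥ −3γ · vol({ℋ > h} ∩ {R(R−r) ≤ |x|²})`: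
  the smeared outward radial `W`-flux of the high set through the layer `R(R−r) ≤ |x|² ≤ R²` is bounded below — its INFLOW part (fast
  Bernoulli-high inflow jets, `⟪x, W⟫ < 0`) is matched ON THE SAME LAYER INSIDE THE SAME HIGH SET by outflow (`⟪x, W⟫ > 0`: turning heads,
  tangential or pressurised high points) up to `3γ·vol(high ∩ far)`.  Proof: exit law between the layer and the fat outer layer `θ_{n,n/2}`,
  `n → ∞`; the outer flux is `≤ 4M[(½ + γ²)·vol_n + 2c_A/n] → 0`;
* member level `…_of_past` / `…_of_selfSimilar` (crux hypotheses verbatim, `0 < ρ ≤ ½`).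

HONEST LABEL: tool (global bookkeeping inequality) for the weak stratum; nothing here excludes a profile.  WHAT THIS IS NOT: not NS, not E —
`--supports` stmt-19832; 19832 OPEN; NS regularity NOT proved. [folklore; ConstantinIgnatovaVicol2026Putative §3.4.1 (3.22), §3.4.3 (3.33);
Leray1934 §6 (1.11); Tao2011 §8 (58)]
-/

noncomputable section

set_option linter.dupNamespace false
-- nested operator types (`innerSL … ∘L …`)
set_option maxSynthPendingDepth 3

open MeasureTheory Set Filter Topology Metric Function TopologicalSpace
open scoped ENNReal NNReal RealInnerProductSpace ContDiff

namespace Summit.NavierStokesRegularity.NavierStokesRegularity.Theorems.PowerGaugeEulerLiouville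

open Literature.Analysis Literature.Analysis.FunctionSpaces Literature.Analysis.FluidPDE

namespace WeakRenormalized

variable {V : EuclideanSpace ℝ (Fin 3) → EuclideanSpace ℝ (Fin 3)} {P : EuclideanSpace ℝ (Fin 3) → ℝ}
  {G : EuclideanSpace ℝ (Fin 3) → EuclideanSpace ℝ (Fin 3) →L[ℝ] EuclideanSpace ℝ (Fin 3)}

/-! ## The turning law -/

section Turning

/-- **THE TURNING LAW FOR THE HIGH SETS OF A WEAK CLASS PROFILE («JETS MUST TURN», no regularity).**  Let `0 ≤ γ ≤ ½`, let `(V, P)` be a weak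
class profile — `V ∈ L⁶(B(0,r))`, `G ∈ L²(B(0,r))`, `P ∈ L^{3/2}(B(0,r))` for every `r`, `V` weakly divergence free, `ℋ = selfSimilarBernoulli γ 0 V P`
with the Lamb-form weak gradient — with the `A`-growth `∫_{B_L}‖V‖² ≤ c_A L` for `L ≥ L₀`, let `0 < r ≤ R`, and let `h` be a level whose far high
set `{ℋ > h} ∩ {R(R−r) ≤ |x|²}` has finite volume.  Then
`−3γ · vol({ℋ > h} ∩ {R(R−r) ≤ |x|²}) ≤ ∫_{ℋ > h} −Dθ_{R,r}(x)[W x] dx`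
(`W = selfSimilarTransport γ 0 V`; `−Dθ_{R,r}(x)[w] = k(x)⟪x, w⟫`, `k ≥ 0` on the layer `R(R−r) ≤ |x|² ≤ R²`, `0` off it).
[folklore; cf. ConstantinIgnatovaVicol2026Putative §3.4.1 (3.22), §3.4.3 (3.33)] -/
theorem highSet_flux_turning_law {γ : ℝ} (hγ0 : 0 ≤ γ) (hγ : γ ≤ 1 / 2)
    (hV6 : ∀ r : ℝ, MemLp V 6 (volume.restrict (ball (0 : EuclideanSpace ℝ (Fin 3)) r)))
    (hG2 : ∀ r : ℝ, MemLp G 2 (volume.restrict (ball (0 : EuclideanSpace ℝ (Fin 3)) r)))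
    (hP32 : ∀ r : ℝ, MemLp P (3 / 2 : ℝ≥0∞) (volume.restrict (ball (0 : EuclideanSpace ℝ (Fin 3)) r)))
    (hdiv : IsWeaklyDivFree V)
    (hH : HasWeakFDerivOn (⊤ : Opens (EuclideanSpace ℝ (Fin 3))) volume (selfSimilarBernoulli γ 0 V P)
      (fun x => (2 * γ - 1) • innerSL ℝ (selfSimilarTransport γ 0 V x) +
        (innerSL ℝ (selfSimilarTransport γ 0 V x)).comp (G x) - innerSL ℝ (G x (selfSimilarTransport γ 0 V x))))
    {cA L₀ : ℝ} (hA : ∀ L : ℝ, L₀ ≤ L → ∫ x in ball (0 : EuclideanSpace ℝ (Fin 3)) L, ‖V x‖ ^ 2 ≤ cA * L)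
    (h : ℝ) {R r : ℝ} (hr : 0 < r) (hrR : r ≤ R)
    (hfin : volume ({x | h < selfSimilarBernoulli γ 0 V P x} ∩ {x : EuclideanSpace ℝ (Fin 3) | R * (R - r) ≤ ‖x‖ ^ 2}) < ⊤) :
    -(3 * γ * (volume ({x | h < selfSimilarBernoulli γ 0 V P x} ∩
        {x : EuclideanSpace ℝ (Fin 3) | R * (R - r) ≤ ‖x‖ ^ 2})).toReal) ≤
      ∫ x in {x | h < selfSimilarBernoulli γ 0 V P x}, -(fderiv ℝ (taoCutoff R r) x (selfSimilarTransport γ 0 V x)) := by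
  obtain ⟨M, hM⟩ := exists_bound_deriv_smoothTransition
  have hM0 : 0 ≤ M := (norm_nonneg _).trans (hM 0)
  have hM' : ∀ s, |deriv Real.smoothTransition s| ≤ M := fun s => by rw [← Real.norm_eq_abs]; exact hM s
  set Hb : EuclideanSpace ℝ (Fin 3) → ℝ := selfSimilarBernoulli γ 0 V P with hHb
  set W : EuclideanSpace ℝ (Fin 3) → EuclideanSpace ℝ (Fin 3) := selfSimilarTransport γ 0 V with hWdef
  set S : Set (EuclideanSpace ℝ (Fin 3)) := {x | h < Hb x} with hSdef
  set Sfar : Set (EuclideanSpace ℝ (Fin 3)) := S ∩ {x | R * (R - r) ≤ ‖x‖ ^ 2} with hSfar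
  set v : ℝ := (volume Sfar).toReal with hvdef
  set F₁ : ℝ := ∫ x in S, -(fderiv ℝ (taoCutoff R r) x (W x)) with hF₁
  have hR : 0 < R := hr.trans_le hrR
  -- measurability of the high set
  have hHl : LocallyIntegrable Hb volume := locallyIntegrableOn_univ.1 (by
    simpa only [Opens.coe_top] using hH.locallyIntegrableOn)
  have hHm : AEStronglyMeasurable Hb volume := hHl.aestronglyMeasurable
  have hS : NullMeasurableSet S volume := nullMeasurableSet_lt aemeasurable_const hHm.aemeasurable
  have hSfarN : NullMeasurableSet Sfar volume :=
    hS.inter (isClosed_le continuous_const (continuous_norm.pow 2)).measurableSet.nullMeasurableSet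
  -- the vanishing error
  set vn : ℕ → ℝ := fun n => (volume (Sfar ∩ {x : EuclideanSpace ℝ (Fin 3) | (n : ℝ) ^ 2 / 2 ≤ ‖x‖ ^ 2})).toReal with hvn
  set ε : ℕ → ℝ := fun n => 4 * M * ((1 / 2 + γ ^ 2) * vn n + 2 * cA / (n : ℝ)) with hεdef
  have hvn0 : Tendsto vn atTop (𝓝 0) := tendsto_volume_inter_far_zero₀ hSfarN hfin
  have hinv : Tendsto (fun n : ℕ => 2 * cA / (n : ℝ)) atTop (𝓝 0) :=
    tendsto_const_div_atTop_nhds_zero_nat _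
  have hε : Tendsto ε atTop (𝓝 0) := by
    have h1 := ((hvn0.const_mul (1 / 2 + γ ^ 2)).add hinv).const_mul (4 * M)
    simp only [mul_zero, add_zero] at h1
    exact h1
  -- the inequality for every large `n`
  have hstep : ∀ n : ℕ, 2 * R ≤ (n : ℝ) → max L₀ 1 ≤ 2 * (n : ℝ) → -F₁ - 3 * γ * v ≤ ε n := by
    intro n hn2 hnL
    have hn : (0 : ℝ) < n := by linarith
    have hn1 : L₀ ≤ 2 * (n : ℝ) := (le_max_left _ _).trans hnL
    have hr₂ : (0 : ℝ) < n / 2 := by linarith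
    have hr₂R : (n : ℝ) / 2 ≤ n := by linarith
    have hnest : R ≤ (n : ℝ) - n / 2 := by linarith
    -- exit law and mass
    have hexit := highSet_flux_exit_law hγ hV6 hG2 hP32 hdiv hH h hr hrR hr₂ hr₂R hnest
    have hmass := setIntegral_sub_taoCutoff_le (S := S) hr hrR hr₂ hr₂R hfin
    -- outer flux
    have hV2 : MemLp V 2 (volume.restrict (ball (0 : EuclideanSpace ℝ (Fin 3)) (2 * n))) := by
      haveI : IsFiniteMeasure ((volume : Measure (EuclideanSpace ℝ (Fin 3))).restrict (ball 0 (2 * n))) :=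
        isFiniteMeasure_restrict.2 measure_ball_lt_top.ne
      exact (hV6 (2 * n)).mono_exponent (by norm_num)
    have hout := abs_highSet_flux_le (γ := γ) (S := S) hr₂ hr₂R hM' hV2
    set An : Set (EuclideanSpace ℝ (Fin 3)) := S ∩ {x | (n : ℝ) * (n - n / 2) ≤ ‖x‖ ^ 2 ∧ ‖x‖ ≤ n} with hAn
    have hAnsub : An ⊆ Sfar ∩ {x : EuclideanSpace ℝ (Fin 3) | (n : ℝ) ^ 2 / 2 ≤ ‖x‖ ^ 2} := by
      intro x hx
      have h1 : (n : ℝ) ^ 2 / 2 ≤ ‖x‖ ^ 2 := by have := hx.2.1; nlinarith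
      refine ⟨⟨hx.1, ?_⟩, h1⟩
      show R * (R - r) ≤ ‖x‖ ^ 2
      nlinarith
    have hTfin : volume (Sfar ∩ {x : EuclideanSpace ℝ (Fin 3) | (n : ℝ) ^ 2 / 2 ≤ ‖x‖ ^ 2}) ≠ ⊤ :=
      ((measure_mono inter_subset_left).trans_lt hfin).ne
    have hvAn : (volume An).toReal ≤ vn n := ENNReal.toReal_mono hTfin (measure_mono hAnsub)
    have hIU : (∫ x in ball (0 : EuclideanSpace ℝ (Fin 3)) (2 * n), ‖V x‖ ^ 2) ≤ cA * (2 * n) := hA (2 * n) hn1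
    have hvAn0 : 0 ≤ (volume An).toReal := ENNReal.toReal_nonneg
    have hout' : |∫ x in S, -(fderiv ℝ (taoCutoff n (n / 2)) x (W x))| ≤ ε n := by
      refine hout.trans ?_
      have hcoef : 2 * M / ((n : ℝ) / 2 * n) = 4 * M / (n : ℝ) ^ 2 := by
        field_simp
        ring
      rw [hcoef]
      show 4 * M / (n : ℝ) ^ 2 * (((n : ℝ) ^ 2 / 2 + γ ^ 2 * (n : ℝ) ^ 2) * (volume An).toReal +
          ∫ x in ball (0 : EuclideanSpace ℝ (Fin 3)) (2 * n), ‖V x‖ ^ 2) ≤ 4 * M * ((1 / 2 + γ ^ 2) * vn n + 2 * cA / (n : ℝ))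
      have hn2' : (0 : ℝ) < (n : ℝ) ^ 2 := by positivity
      have h1 : ((n : ℝ) ^ 2 / 2 + γ ^ 2 * (n : ℝ) ^ 2) * (volume An).toReal ≤ ((n : ℝ) ^ 2 / 2 + γ ^ 2 * (n : ℝ) ^ 2) * vn n :=
        mul_le_mul_of_nonneg_left hvAn (by positivity)
      have e : 4 * M * ((1 / 2 + γ ^ 2) * vn n + 2 * cA / (n : ℝ)) =
          4 * M / (n : ℝ) ^ 2 * (((n : ℝ) ^ 2 / 2 + γ ^ 2 * (n : ℝ) ^ 2) * vn n + cA * (2 * n)) := by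
        field_simp
      rw [e]
      exact mul_le_mul_of_nonneg_left (by linarith) (by positivity)
    have habs := neg_abs_le (∫ x in S, -(fderiv ℝ (taoCutoff n (n / 2)) x (W x)))
    have hγv : 3 * γ * (∫ x in S, (taoCutoff (↑n) (↑n / 2) x - taoCutoff R r x)) ≤ 3 * γ * v :=
      mul_le_mul_of_nonneg_left hmass (by positivity)
    linarith
  have hev : ∀ᶠ n : ℕ in atTop, -F₁ - 3 * γ * v ≤ ε n := by
    filter_upwards [eventually_ge_atTop (max ⌈2 * R⌉₊ ⌈max L₀ 1⌉₊)] with n hn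
    have hn2 : ⌈2 * R⌉₊ ≤ n := (le_max_left _ _).trans hn
    have hn3 : ⌈max L₀ 1⌉₊ ≤ n := (le_max_right _ _).trans hn
    have hnn : (0 : ℝ) ≤ n := Nat.cast_nonneg n
    refine hstep n ((Nat.le_ceil _).trans (Nat.cast_le.2 hn2)) ?_
    exact ((Nat.le_ceil _).trans (Nat.cast_le.2 hn3)).trans (by linarith)
  have hfinal : -F₁ - 3 * γ * v ≤ 0 := ge_of_tendsto hε hev
  linarith

end Turning

/-! ## Member level -/

section Member

/-- **«JETS MUST TURN» FOR A PAST-EXACT SELF-SIMILAR CLASS MEMBER** (`0 < ρ ≤ ½`, `γ = 1/(2+ρ)`; NO regularity of the profile): crux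
hypotheses verbatim, exact self-similarity about `(T, x₀)` for `τ < T₁` (`T₁ ≤ 0`, `T₁ ≤ T`) ⇒ for every layer `0 < r ≤ R` and every level
`h` whose far high set has finite volume, `−3γ·vol({ℋ > h} ∩ {R(R−r) ≤ |x|²}) ≤ ∫_{ℋ > h} −Dθ_{R,r}[W]`.  (`Past.profileData_of_past`: the
`A`-growth `∫_{B_L}‖V‖² ≤ C L^{1−2ρ} ≤ C L` for `L ≥ max (2−T₁) 1`.) [folklore] -/
theorem highSet_flux_turning_law_of_past {ρ : ℝ} (hρ : 0 < ρ) (hρh : ρ ≤ 1 / 2)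
    {T T₁ : ℝ} (hT₁ : T₁ ≤ 0) (hTT₁ : T₁ ≤ T) (x₀ : EuclideanSpace ℝ (Fin 3))
    {u : ℝ → EuclideanSpace ℝ (Fin 3) → EuclideanSpace ℝ (Fin 3)} {p : ℝ → EuclideanSpace ℝ (Fin 3) → ℝ}
    {H : ℝ → EuclideanSpace ℝ (Fin 3) → EuclideanSpace ℝ (Fin 3) →L[ℝ] EuclideanSpace ℝ (Fin 3)} {c : ℝ≥0}
    (hsw : IsSuitableWeakSolutionOn (slab (EuclideanSpace ℝ (Fin 3)) (Iio 0) isOpen_Iio) 0 0 u p)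
    (hH : HasWeakSpatialGradientOn (slab (EuclideanSpace ℝ (Fin 3)) (Iio 0) isOpen_Iio) u H)
    (hgauge : ∀ a : ℝ, 0 < a →
      ENNReal.ofReal (a ^ (2 * ρ)) * cknA a (0 : ℝ × EuclideanSpace ℝ (Fin 3)) u +
          ENNReal.ofReal (a ^ ρ) * cknE a (0 : ℝ × EuclideanSpace ℝ (Fin 3)) H +
        ENNReal.ofReal (a ^ (2 * ρ)) * cknD a (0 : ℝ × EuclideanSpace ℝ (Fin 3)) p ≤ (c : ℝ≥0∞))
    {V : EuclideanSpace ℝ (Fin 3) → EuclideanSpace ℝ (Fin 3)} {P : EuclideanSpace ℝ (Fin 3) → ℝ}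
    (hu : ∀ τ : ℝ, τ < T₁ → u τ = fun x => selfSimilarCollapse (1 / (2 + ρ)) T V τ (x - x₀))
    (hp : ∀ τ : ℝ, τ < T₁ → p τ = fun x => selfSimilarCollapsePressure (1 / (2 + ρ)) T P τ (x - x₀))
    (h : ℝ) {R r : ℝ} (hr : 0 < r) (hrR : r ≤ R)
    (hfin : volume ({x | h < selfSimilarBernoulli (1 / (2 + ρ)) 0 V P x} ∩
      {x : EuclideanSpace ℝ (Fin 3) | R * (R - r) ≤ ‖x‖ ^ 2}) < ⊤) :
    -(3 * (1 / (2 + ρ)) * (volume ({x | h < selfSimilarBernoulli (1 / (2 + ρ)) 0 V P x} ∩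
        {x : EuclideanSpace ℝ (Fin 3) | R * (R - r) ≤ ‖x‖ ^ 2})).toReal) ≤
      ∫ x in {x | h < selfSimilarBernoulli (1 / (2 + ρ)) 0 V P x},
        -(fderiv ℝ (taoCutoff R r) x (selfSimilarTransport (1 / (2 + ρ)) 0 V x)) := by
  have hγ0 : 0 ≤ 1 / (2 + ρ) := by positivity
  have hγ : 1 / (2 + ρ) ≤ 1 / 2 := by
    rw [div_le_div_iff₀ (by linarith) (by norm_num)]; linarith
  have hA : ∀ a : ℝ, 0 < a → ENNReal.ofReal (a ^ (2 * ρ)) *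
      cknA a (0 : ℝ × EuclideanSpace ℝ (Fin 3)) u ≤ (c : ℝ≥0∞) :=
    fun a ha => le_trans (le_trans le_self_add le_self_add) (hgauge a ha)
  have hE : ∀ a : ℝ, 0 < a → ENNReal.ofReal (a ^ ρ) *
      cknE a (0 : ℝ × EuclideanSpace ℝ (Fin 3)) H ≤ (c : ℝ≥0∞) :=
    fun a ha => le_trans (le_trans le_add_self le_self_add) (hgauge a ha)
  have hD : ∀ a : ℝ, 0 < a → ENNReal.ofReal (a ^ (2 * ρ)) *
      cknD a (0 : ℝ × EuclideanSpace ℝ (Fin 3)) p ≤ (c : ℝ≥0∞) :=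
    fun a ha => le_trans le_add_self (hgauge a ha)
  obtain ⟨G, hVm, hPm, -, hVG, -, ⟨CA, hCA, hAgr⟩, -, -, hV6, hG2, hP32, hdiv, heq, -, -⟩ :=
    Past.profileData_of_past hρ hρh hT₁ hTT₁ x₀ hsw.distributional hH hA hE hD hu hp
  have hHb := WeakBernoulli.hasWeakFDerivOn_bernoulli hV6 hVG hG2
    (WeakPressure.hasWeakFDerivOn_pressure hVm hPm hV6 hVG hG2 hP32 hdiv heq)
  -- the `A`-growth in the form `∫_{B_L}‖V‖² ≤ c_A L`
  have hA1 : ∀ L : ℝ, max (2 - T₁) 1 ≤ L → ∫ x in ball (0 : EuclideanSpace ℝ (Fin 3)) L, ‖V x‖ ^ 2 ≤ CA.toReal * L := by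
    intro L hL
    have hL1 : 1 ≤ L := le_trans (le_max_right _ _) hL
    haveI : IsFiniteMeasure ((volume : Measure (EuclideanSpace ℝ (Fin 3))).restrict (ball 0 L)) :=
      isFiniteMeasure_restrict.2 measure_ball_lt_top.ne
    have h1 : ∫⁻ y in ball (0 : EuclideanSpace ℝ (Fin 3)) L, ‖V y‖ₑ ^ 2 ≤ ENNReal.ofReal (CA.toReal * L ^ (1 - 2 * ρ)) := by
      rw [ENNReal.ofReal_mul ENNReal.toReal_nonneg, ENNReal.ofReal_toReal hCA]
      exact hAgr L (le_trans (le_max_left _ _) hL)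
    have h2 := setIntegral_norm_sq_le_of_lintegral_le (by positivity) ((hV6 L).mono_exponent (by norm_num)) h1
    refine h2.trans (mul_le_mul_of_nonneg_left ?_ ENNReal.toReal_nonneg)
    calc L ^ (1 - 2 * ρ) ≤ L ^ (1 : ℝ) := Real.rpow_le_rpow_of_exponent_le hL1 (by linarith)
      _ = L := Real.rpow_one L
  exact highSet_flux_turning_law hγ0 hγ hV6 hG2 hP32 hdiv hHb hA1 h hr hrR hfin

/-- **«JETS MUST TURN» FOR AN EXACTLY SELF-SIMILAR CLASS MEMBER (origin-centred; binder shape of the skeleton's `IsExactlySelfSimilar`).**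
Crux hypotheses verbatim, `0 < ρ ≤ ½`, `u(τ) = selfSimilarCollapse γ 0 V τ`, `p(τ) = selfSimilarCollapsePressure γ 0 P τ` for `τ < 0`: for every
layer `0 < r ≤ R` and every level `h` whose far high set has finite volume,
`−3γ·vol({ℋ > h} ∩ {R(R−r) ≤ |x|²}) ≤ ∫_{ℋ > h} −Dθ_{R,r}[W]` — the inflow flux of every Bernoulli high set of the genuinely weak member through
every sphere layer is matched by outflow flux inside the same high set, with no flow and no regularity. [folklore] -/
theorem highSet_flux_turning_law_of_selfSimilar {ρ : ℝ} (hρ : 0 < ρ) (hρh : ρ ≤ 1 / 2)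
    {u : ℝ → EuclideanSpace ℝ (Fin 3) → EuclideanSpace ℝ (Fin 3)} {p : ℝ → EuclideanSpace ℝ (Fin 3) → ℝ}
    {H : ℝ → EuclideanSpace ℝ (Fin 3) → EuclideanSpace ℝ (Fin 3) →L[ℝ] EuclideanSpace ℝ (Fin 3)} {c : ℝ≥0}
    (hsw : IsSuitableWeakSolutionOn (slab (EuclideanSpace ℝ (Fin 3)) (Iio 0) isOpen_Iio) 0 0 u p)
    (hH : HasWeakSpatialGradientOn (slab (EuclideanSpace ℝ (Fin 3)) (Iio 0) isOpen_Iio) u H)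
    (hgauge : ∀ a : ℝ, 0 < a →
      ENNReal.ofReal (a ^ (2 * ρ)) * cknA a (0 : ℝ × EuclideanSpace ℝ (Fin 3)) u +
          ENNReal.ofReal (a ^ ρ) * cknE a (0 : ℝ × EuclideanSpace ℝ (Fin 3)) H +
        ENNReal.ofReal (a ^ (2 * ρ)) * cknD a (0 : ℝ × EuclideanSpace ℝ (Fin 3)) p ≤ (c : ℝ≥0∞))
    {V : EuclideanSpace ℝ (Fin 3) → EuclideanSpace ℝ (Fin 3)} {P : EuclideanSpace ℝ (Fin 3) → ℝ}
    (hu : ∀ τ : ℝ, τ < 0 → u τ = selfSimilarCollapse (1 / (2 + ρ)) 0 V τ)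
    (hp : ∀ τ : ℝ, τ < 0 → p τ = selfSimilarCollapsePressure (1 / (2 + ρ)) 0 P τ)
    (h : ℝ) {R r : ℝ} (hr : 0 < r) (hrR : r ≤ R)
    (hfin : volume ({x | h < selfSimilarBernoulli (1 / (2 + ρ)) 0 V P x} ∩
      {x : EuclideanSpace ℝ (Fin 3) | R * (R - r) ≤ ‖x‖ ^ 2}) < ⊤) :
    -(3 * (1 / (2 + ρ)) * (volume ({x | h < selfSimilarBernoulli (1 / (2 + ρ)) 0 V P x} ∩
        {x : EuclideanSpace ℝ (Fin 3) | R * (R - r) ≤ ‖x‖ ^ 2})).toReal) ≤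
      ∫ x in {x | h < selfSimilarBernoulli (1 / (2 + ρ)) 0 V P x},
        -(fderiv ℝ (taoCutoff R r) x (selfSimilarTransport (1 / (2 + ρ)) 0 V x)) := by
  have hu' : ∀ τ : ℝ, τ < 0 → u τ = fun x => selfSimilarCollapse (1 / (2 + ρ)) 0 V τ (x - 0) :=
    fun τ hτ => by rw [hu τ hτ]; funext x; rw [sub_zero]
  have hp' : ∀ τ : ℝ, τ < 0 → p τ = fun x => selfSimilarCollapsePressure (1 / (2 + ρ)) 0 P τ (x - 0) :=
    fun τ hτ => by rw [hp τ hτ]; funext x; rw [sub_zero]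
  exact highSet_flux_turning_law_of_past hρ hρh le_rfl le_rfl 0 hsw hH hgauge hu' hp' h hr hrR hfin

end Member

end WeakRenormalized

end Summit.NavierStokesRegularity.NavierStokesRegularity.Theorems.PowerGaugeEulerLiouville
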